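import Mathlib
import Summits.Ventures.FusionMHD.Models.SAlphaSecondStableS3A6Core0
import HarnessLib

/-!
# STABLE-POINT core at `(3, 6)`, piece 8 (`[4, 6]`): kernel-decided Taylor-model leaves ⇒ `F_8 > 0` and `amplitudeResidual 3 (6) F_8 F_8″ ≤ 0` on the piece ⇒ `EnergyDominatesOn` for its amplitude phase

LADDER-GRIDFUSION rung F3 («F3.BALLOON-sα-SECOND-STABILITY-S3-A6»: the first certified point on the SECOND-STABILITY side of the s–α model (DIRECTOR RULING 67 (5) class)); gridfusion-model-7 g9, 2026-08-28 (g8's core lane).  Two `decide +kernel` calls (`OpModel.trig.pLeavesCheck`, scale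
`2^60`, Taylor degree 10, 16 leaves of half-width 1/16) and the lane's soundness theorem `OpSem.trig.pos_of_pLeavesCheck`
(Literature/Analysis/ValidatedNumerics/TaylorModelZeroCert); lit-4's `energyDominatesOn_of_amplitude` (BallooningSAlphaStableSide) turns the two
sign facts into energy domination by `amplitudePhase 3 (6) F_8 F_8′` on the piece.  MODELLED: `s–α` model; nothing about a device.
No `native_decide`.  Citations: Freidberg 2014 §12.6.2 (12.97) [Freidberg2014]; Makino–Berz 2003 Alg. 2 [MakinoBerz2003]; Hartman 2002 XI.6.2
[Hartman2002].  Everything here is [instance data].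
-/

open Literature.Analysis.ValidatedNumerics Literature.Analysis.ValidatedNumerics.PolyMP
open Literature.Analysis.ValidatedNumerics.NumericsMP Literature.Analysis.ValidatedNumerics.ExpPoly
open Literature.MathematicalPhysics.MHD.Ballooning
open Real Set

namespace Summit.Ventures.FusionMHD.Models

namespace SAlphaSecondStableS3A6

/-- KERNEL CHECK (residual leaves of piece 8). [instance data] -/
theorem ss36_res8_ok : OpModel.trig.pLeavesCheck ss36Prm2 (2 ^ 60) (ss36Prog G8 (Poly.deriv (Poly.deriv G8))) [] ss36LeavesB8 = true := by
  decide +kernel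

/-- KERNEL CHECK (positivity leaves of piece 8). [instance data] -/
theorem ss36_pos8_ok : OpModel.trig.pLeavesCheck ss36Prm2 (2 ^ 60) (ss36PosProg G8) [] ss36LeavesB8 = true := by
  decide +kernel

/-- The leaves tile `[4, 6]`. [instance data] -/
theorem ss36_tiles8 : tiles (4 : ℚ) (ss36LeavesB8.map fun l => (l.e, l.k)) (6 : ℚ) = true := by
  decide +kernel

/-- **PIECE 8**: the phase of `F_8` dominates the `s–α` energy on `[4, 6]` at `(s, α) = (3, 6)`. [instance data] -/
theorem ss36_dominates8 :
    SAlpha.EnergyDominatesOn 3 (6) (SAlpha.amplitudePhase 3 (6) (Poly.eval G8) (Poly.eval (Poly.deriv G8)))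
      (Icc (4 : ℝ) (6 : ℝ)) := by
  have h := ss36_dominates (lf := G8) (x := 4) (y := 6) (by norm_num) ss36_tiles8 ss36_res8_ok ss36_pos8_ok
  norm_num at h
  exact h

end SAlphaSecondStableS3A6

end Summit.Ventures.FusionMHD.Models
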